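import Mathlib
import Summits.QuantumFields.YangMills.Theorems.RationalShortRootRigidityOpenVanishing
import Summits.QuantumFields.YangMills.Theorems.RationalShortRootRigidityFullDegMul
import Summits.QuantumFields.YangMills.Theorems.RationalShortRootRigidityAlternationShell

/-!
# `RationalShortRootRigidity` — Step 4 (`stub_alternation`) assembly, part V: peeling toolkit

Part of the ASSEMBLY of Step 4 of the paper proof of crux `stmt-QuantumFields-23124`
(`F4SubCurvatureDoor.RationalShortRootRigidity`, LINE g15-A of planner ym-idea-3; birth skeleton
HOME l15/RationalShortRootRigidity-birth.lean, stub `stub_alternation`; plan HOME l15/STUB-PLAN-Alternation.md §0).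

The typed stub has a GENERAL radial denominator `D₀ = R(p²)`; the alternation core (part I) wants SIMPLE REAL shells.  The
reduction («peeling») removes a non-real root pair or a multiple real root of `R` as a common radial factor `T(p²)` of
`(N₀, D₀)`.  Generic algebra for that, proved here:

* `eq_zero_of_two_roots` — a complex polynomial of degree `≤ 1` with two distinct roots is `0`;
* `quadFactor_*` — the real quadratic `T_z = X² − 2(Re z)X + |z|²` of a non-real `z`: monic, `T_z(z) = T_z(z̄) = 0`, and
  `T_z ∣ P` for every REAL polynomial `P` with `P(z) = 0`;
* `exists_shellFactor` — if a monic `T ≠ 1` divides every fibre polynomial `X ↦ E(X, q)` (`q ≠ 0` real), then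
  `E = T(X)·E₁` in `ℝ[X, q]` (division with remainder in `ℝ[q][X]`; the remainder's coefficients vanish on `{q ≠ 0}`,
  hence identically — tree lemma `eq_zero_of_eval_eq_zero_on_open`, p669358);
* `eval_aeval_sumSq`, `eval_cons_shell` — evaluation bookkeeping for `T(Σpᵢ²)` and `Ψ(E)(t, q) = E(t² + |q|², q)`;
* `fullDeg_aeval_sumSq` — `T(Σpᵢ²)` has full degree in `p₀` (top coefficient `= 1` for monic `T`), the input of the tree
  lemma `stieltjesTransfer` (p668794);
* `invariant_of_mul_radial` — an invariance of `H·N₁` under a map preserving `Σpᵢ²` passes to `N₁` when `H = T(Σpᵢ²) ≠ 0`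
  (cancel on the dense set `{H ≠ 0}`, tree lemma `dense_setOf_eval_ne_zero`);
* `derivative_eval_root_of_mul` — `((X − ρ)Q)′(ρ) = Q(ρ)`.

Mathlib + tree lemmas; THEOREMS ONLY; no named facts; no `sorry`; default heartbeats.  Nothing about the crux 23124, the route's
rung or the Yang–Mills mass gap is proved here.  Free-hands width seat `ym-line-sfw-p2-w4` g18, `--supports stmt-QuantumFields-23124`.
-/

set_option autoImplicit false

namespace Summit.QuantumFields.YangMills.Theorems.RationalShortRootRigidity.Alternation

open scoped BigOperators Polynomial ComplexConjugate

/-! ### 1. Two roots kill a linear polynomial -/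

/-- A complex polynomial of degree `≤ 1` vanishing at two distinct points is zero. [folklore] -/
theorem eq_zero_of_two_roots (p : ℂ[X]) (hp : p.natDegree ≤ 1) (z w : ℂ) (hzw : z ≠ w)
    (hz : p.eval z = 0) (hw : p.eval w = 0) : p = 0 := by
  have hform := Polynomial.eq_X_add_C_of_natDegree_le_one hp
  rw [hform] at hz hw
  simp only [Polynomial.eval_add, Polynomial.eval_mul, Polynomial.eval_C, Polynomial.eval_X] at hz hw
  have h1 : p.coeff 1 * (z - w) = 0 := by linear_combination hz - hw
  have hc1 : p.coeff 1 = 0 := by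
    rcases mul_eq_zero.1 h1 with h | h
    · exact h
    · exact absurd (sub_eq_zero.1 h) hzw
  have hc0 : p.coeff 0 = 0 := by
    rw [hc1] at hz
    simpa using hz
  rw [hform, hc1, hc0]
  simp

/-! ### 2. The real quadratic factor of a non-real root -/

/-- `T_z(z) = 0` for `T_z = X² − 2(Re z)X + |z|²`. [folklore] -/
theorem quadFactor_aeval_self (z : ℂ) :
    Polynomial.aeval z (Polynomial.X ^ 2 - Polynomial.C (2 * z.re) * Polynomial.X +
      Polynomial.C (Complex.normSq z) : ℝ[X]) = 0 := by
  simp only [map_add, map_sub, map_mul, map_pow, Polynomial.aeval_X, Polynomial.aeval_C, Complex.coe_algebraMap]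
  apply Complex.ext
  · simp [Complex.normSq_apply, sq]
    ring
  · simp [Complex.normSq_apply, sq]
    ring

/-- `T_z(z̄) = 0`. [folklore] -/
theorem quadFactor_aeval_conj (z : ℂ) :
    Polynomial.aeval (conj z) (Polynomial.X ^ 2 - Polynomial.C (2 * z.re) * Polynomial.X +
      Polynomial.C (Complex.normSq z) : ℝ[X]) = 0 := by
  rw [Polynomial.aeval_conj, quadFactor_aeval_self, map_zero]

/-- `T_z` is monic of degree `2`. [folklore] -/
theorem quadFactor_monic (z : ℂ) :
    (Polynomial.X ^ 2 - Polynomial.C (2 * z.re) * Polynomial.X + Polynomial.C (Complex.normSq z) : ℝ[X]).Monic ∧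
    (Polynomial.X ^ 2 - Polynomial.C (2 * z.re) * Polynomial.X +
      Polynomial.C (Complex.normSq z) : ℝ[X]).natDegree = 2 := by
  have h : (Polynomial.X ^ 2 - Polynomial.C (2 * z.re) * Polynomial.X + Polynomial.C (Complex.normSq z) : ℝ[X]) =
      Polynomial.X ^ 2 + (Polynomial.C (-(2 * z.re)) * Polynomial.X + Polynomial.C (Complex.normSq z)) := by
    rw [map_neg]
    ring
  have hlow : (Polynomial.C (-(2 * z.re)) * Polynomial.X + Polynomial.C (Complex.normSq z) : ℝ[X]).degree < 2 := by
    refine lt_of_le_of_lt (Polynomial.degree_add_le _ _) (max_lt ?_ ?_)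
    · exact lt_of_le_of_lt (Polynomial.degree_C_mul_X_le _) (by exact_mod_cast (by norm_num : (1 : ℕ) < 2))
    · exact lt_of_le_of_lt Polynomial.degree_C_le (by exact_mod_cast (by norm_num : (0 : ℕ) < 2))
  rw [h]
  have hdeg : (Polynomial.X ^ 2 : ℝ[X]).degree = 2 := by
    rw [Polynomial.degree_X_pow]
    rfl
  refine ⟨?_, ?_⟩
  · exact Polynomial.Monic.add_of_left (Polynomial.monic_X_pow 2) (hdeg ▸ hlow)
  · rw [Polynomial.natDegree_add_eq_left_of_degree_lt (hdeg ▸ hlow), Polynomial.natDegree_X_pow]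

/-- A REAL polynomial vanishing at a non-real `z` is divisible by `T_z` (the remainder mod `T_z` has degree `≤ 1` and
vanishes at `z ≠ z̄`). [folklore] -/
theorem quadFactor_dvd (z : ℂ) (hz : z.im ≠ 0) (P : ℝ[X]) (hP : Polynomial.aeval z P = 0) :
    (Polynomial.X ^ 2 - Polynomial.C (2 * z.re) * Polynomial.X + Polynomial.C (Complex.normSq z) : ℝ[X]) ∣ P := by
  set T : ℝ[X] := Polynomial.X ^ 2 - Polynomial.C (2 * z.re) * Polynomial.X + Polynomial.C (Complex.normSq z) with hT
  obtain ⟨hmon, hdeg⟩ := quadFactor_monic z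
  rw [← Polynomial.modByMonic_eq_zero_iff_dvd hmon]
  have hT1 : T ≠ 1 := by
    intro h1
    have := congrArg Polynomial.natDegree h1
    rw [hdeg, Polynomial.natDegree_one] at this
    exact absurd this (by norm_num)
  have hlt : (P %ₘ T).natDegree < 2 := hdeg ▸ Polynomial.natDegree_modByMonic_lt P hmon hT1
  -- the remainder vanishes at `z` and `z̄`
  have hdecomp := Polynomial.modByMonic_add_div P T
  have hrem : ∀ w : ℂ, Polynomial.aeval w T = 0 → Polynomial.aeval w P = 0 → Polynomial.aeval w (P %ₘ T) = 0 := by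
    intro w hwT hwP
    have h := congrArg (Polynomial.aeval w) hdecomp
    rw [map_add, map_mul, hwT, zero_mul, add_zero, hwP] at h
    exact h
  have hz1 := hrem z (quadFactor_aeval_self z) hP
  have hz2 := hrem (conj z) (quadFactor_aeval_conj z) (by rw [Polynomial.aeval_conj, hP, map_zero])
  have hne : z ≠ conj z := by
    intro h
    exact hz (Complex.conj_eq_iff_im.1 h.symm)
  -- hence it is zero over `ℂ`, hence over `ℝ`
  have hmap : (P %ₘ T).map (algebraMap ℝ ℂ) = 0 := by
    refine eq_zero_of_two_roots _ (le_trans (Polynomial.natDegree_map_le) (by omega)) z (conj z) hne ?_ ?_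
    · rwa [Polynomial.eval_map, ← Polynomial.aeval_def]
    · rwa [Polynomial.eval_map, ← Polynomial.aeval_def]
  exact (Polynomial.map_eq_zero_iff (algebraMap ℝ ℂ).injective).1 hmap

/-! ### 3. Fibrewise divisibility ⇒ divisibility in `ℝ[X, q]` -/

/-- `aeval X T = T.map (algebraMap ℝ S)` (base change of a real polynomial). [folklore] -/
theorem aeval_X_eq_map (S : Type*) [CommRing S] [Algebra ℝ S] (T : ℝ[X]) :
    Polynomial.aeval (Polynomial.X : S[X]) T = T.map (algebraMap ℝ S) := by
  induction T using Polynomial.induction_on' with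
  | add p q hp hq => rw [map_add, Polynomial.map_add, hp, hq]
  | monomial n a =>
    rw [Polynomial.aeval_monomial, Polynomial.map_monomial, Polynomial.algebraMap_apply,
      Polynomial.C_mul_X_pow_eq_monomial]

/-- `finSuccEquiv.symm (T.map (algebraMap ℝ ℝ[q])) = T(X₀)`. [folklore] -/
theorem finSuccEquiv_symm_map (T : ℝ[X]) :
    (MvPolynomial.finSuccEquiv ℝ 3).symm (T.map (algebraMap ℝ (MvPolynomial (Fin 3) ℝ))) =
      Polynomial.aeval (MvPolynomial.X 0 : MvPolynomial (Fin 4) ℝ) T := by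
  apply (MvPolynomial.finSuccEquiv ℝ 3).injective
  rw [AlgEquiv.apply_symm_apply, ← Polynomial.aeval_algHom_apply, MvPolynomial.finSuccEquiv_X_zero, aeval_X_eq_map]

/-- `(T.map (algebraMap ℝ ℝ[q])).map (eval q) = T`. [folklore] -/
theorem map_map_eval (T : ℝ[X]) (q : Fin 3 → ℝ) :
    (T.map (algebraMap ℝ (MvPolynomial (Fin 3) ℝ))).map (MvPolynomial.eval q) = T := by
  rw [Polynomial.map_map]
  have : (MvPolynomial.eval q).comp (algebraMap ℝ (MvPolynomial (Fin 3) ℝ)) = RingHom.id ℝ := by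
    ext x
    simp [MvPolynomial.algebraMap_eq]
  rw [this, Polynomial.map_id]

/-- **Fibrewise divisibility ⇒ global divisibility.**  If a monic `T ≠ 1` divides the fibre polynomial `X ↦ E(X, q)` for every
real `q ≠ 0`, then `E = T(X₀)·E₁`. [folklore] -/
theorem exists_shellFactor (T : ℝ[X]) (hT : T.Monic) (hT1 : T ≠ 1) (E : MvPolynomial (Fin 4) ℝ)
    (hdiv : ∀ q : Fin 3 → ℝ, q ≠ 0 → T ∣ Polynomial.map (MvPolynomial.eval q) (MvPolynomial.finSuccEquiv ℝ 3 E)) :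
    ∃ E₁ : MvPolynomial (Fin 4) ℝ, E = Polynomial.aeval (MvPolynomial.X 0 : MvPolynomial (Fin 4) ℝ) T * E₁ := by
  classical
  set F := MvPolynomial.finSuccEquiv ℝ 3 E with hF
  set TS : Polynomial (MvPolynomial (Fin 3) ℝ) := T.map (algebraMap ℝ (MvPolynomial (Fin 3) ℝ)) with hTS
  have hTSmon : TS.Monic := hT.map _
  have hTS1 : TS ≠ 1 := by
    intro h1
    apply hT1
    have h := congrArg (Polynomial.map (MvPolynomial.eval (0 : Fin 3 → ℝ))) h1
    rw [hTS, map_map_eval, Polynomial.map_one] at h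
    exact h
  -- division with remainder in `ℝ[q][X]`
  have hdecomp := Polynomial.modByMonic_add_div F TS
  have hremdeg : (F %ₘ TS).natDegree < T.natDegree := by
    have := Polynomial.natDegree_modByMonic_lt F hTSmon hTS1
    rwa [hTS, Polynomial.natDegree_map_eq_of_injective (algebraMap ℝ (MvPolynomial (Fin 3) ℝ)).injective] at this
  -- every fibre of the remainder vanishes
  have hremfib : ∀ q : Fin 3 → ℝ, q ≠ 0 → (F %ₘ TS).map (MvPolynomial.eval q) = 0 := by
    intro q hq
    have h := congrArg (Polynomial.map (MvPolynomial.eval q)) hdecomp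
    rw [Polynomial.map_add, Polynomial.map_mul, hTS, map_map_eval] at h
    -- `T ∣ A_q = rem_q + T * Q_q`, so `T ∣ rem_q`, which has degree `< deg T`
    have hdvd : T ∣ (F %ₘ T.map (algebraMap ℝ (MvPolynomial (Fin 3) ℝ))).map (MvPolynomial.eval q) := by
      have h1 := hdiv q hq
      rw [← h] at h1
      exact (dvd_add_left (dvd_mul_right T _)).1 h1
    refine Polynomial.eq_zero_of_dvd_of_natDegree_lt hdvd ?_
    exact lt_of_le_of_lt Polynomial.natDegree_map_le hremdeg
  -- hence the remainder is zero
  have hrem : F %ₘ TS = 0 := by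
    refine Polynomial.ext fun i => ?_
    rw [Polynomial.coeff_zero]
    refine eq_zero_of_eval_eq_zero_on_open _ {q : Fin 3 → ℝ | q ≠ 0} isOpen_ne ⟨fun _ => 1, ?_⟩ ?_
    · show (fun _ : Fin 3 => (1 : ℝ)) ≠ 0
      intro h
      have := congrFun h 0
      simp at this
    · intro q hq
      have h := congrArg (fun P : ℝ[X] => P.coeff i) (hremfib q hq)
      simp only [Polynomial.coeff_map, Polynomial.coeff_zero] at h
      exact h
  rw [hrem, zero_add] at hdecomp
  refine ⟨(MvPolynomial.finSuccEquiv ℝ 3).symm (F /ₘ TS), ?_⟩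
  apply (MvPolynomial.finSuccEquiv ℝ 3).injective
  rw [map_mul, ← finSuccEquiv_symm_map, AlgEquiv.apply_symm_apply, AlgEquiv.apply_symm_apply, ← hTS, hdecomp]

/-! ### 4. Evaluation bookkeeping -/

/-- `T(Σᵢ Xᵢ²)(p) = T(Σᵢ pᵢ²)`. [folklore] -/
theorem eval_aeval_sumSq (T : ℝ[X]) (p : Fin 4 → ℝ) :
    MvPolynomial.eval p (Polynomial.aeval (∑ j : Fin 4, (MvPolynomial.X j : MvPolynomial (Fin 4) ℝ) ^ 2) T) =
      T.eval (∑ j : Fin 4, p j ^ 2) := by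
  induction T using Polynomial.induction_on' with
  | add f g hf hg => simp only [map_add, Polynomial.eval_add, hf, hg]
  | monomial n a =>
    simp only [Polynomial.aeval_monomial, MvPolynomial.algebraMap_eq, map_mul, map_pow, MvPolynomial.eval_C, map_sum,
      MvPolynomial.eval_X, Polynomial.eval_monomial]

/-- `T(X₀)` in the shell picture is `T(Σᵢ Xᵢ²)`: `Ψ(T(X₀)) = T(Σ Xᵢ²)`. [folklore] -/
theorem shell_aeval_X0 (T : ℝ[X]) :
    MvPolynomial.bind₁
      (fun i : Fin 4 => if i = 0 then ∑ j : Fin 4, (MvPolynomial.X j : MvPolynomial (Fin 4) ℝ) ^ 2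
        else MvPolynomial.X i) (Polynomial.aeval (MvPolynomial.X 0 : MvPolynomial (Fin 4) ℝ) T) =
      Polynomial.aeval (∑ j : Fin 4, (MvPolynomial.X j : MvPolynomial (Fin 4) ℝ) ^ 2) T := by
  rw [← Polynomial.aeval_algHom_apply, MvPolynomial.bind₁_X_right]
  simp only [↓reduceIte]

/-- `Σⱼ (cons t q)ⱼ² = t² + |q|²`. [folklore] -/
theorem sumSq_cons (t : ℝ) (q : Fin 3 → ℝ) :
    ∑ j : Fin 4, (Fin.cons t q : Fin 4 → ℝ) j ^ 2 = t ^ 2 + ∑ i, q i ^ 2 := by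
  rw [Fin.sum_univ_succ]
  simp only [Fin.cons_zero, Fin.cons_succ]

/-- `Ψ(E)(t, q) = E(t² + |q|², q)`. [folklore] -/
theorem eval_cons_shell (E : MvPolynomial (Fin 4) ℝ) (t : ℝ) (q : Fin 3 → ℝ) :
    MvPolynomial.eval (Fin.cons t q : Fin 4 → ℝ) (MvPolynomial.bind₁
      (fun i : Fin 4 => if i = 0 then ∑ j : Fin 4, (MvPolynomial.X j : MvPolynomial (Fin 4) ℝ) ^ 2
        else MvPolynomial.X i) E) =
      MvPolynomial.eval (Fin.cons (t ^ 2 + ∑ i, q i ^ 2) q : Fin 4 → ℝ) E := by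
  rw [eval_shell, sumSq_cons, Fin.tail_cons]

/-! ### 5. Full degree of `T(Σ Xᵢ²)` -/

/-- The top `p₀`-coefficient and the total degree of `(Σᵢ Xᵢ²)^n`. [folklore] -/
theorem sumSq_pow_top (n : ℕ) :
    ((∑ j : Fin 4, (MvPolynomial.X j : MvPolynomial (Fin 4) ℝ) ^ 2) ^ n).totalDegree = 2 * n ∧
    MvPolynomial.coeff (Finsupp.single 0 (2 * n))
      ((∑ j : Fin 4, (MvPolynomial.X j : MvPolynomial (Fin 4) ℝ) ^ 2) ^ n) = 1 := by
  classical
  set S := ∑ j : Fin 4, (MvPolynomial.X j : MvPolynomial (Fin 4) ℝ) ^ 2 with hS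
  have hScoeff : MvPolynomial.coeff (Finsupp.single 0 2) S = 1 := by
    rw [hS, MvPolynomial.coeff_sum]
    simp only [MvPolynomial.coeff_X_pow, Finsupp.single_left_inj (two_ne_zero), Finset.sum_ite_eq', Finset.mem_univ,
      if_true]
  have hSne : S ≠ 0 := by
    intro h
    rw [h, MvPolynomial.coeff_zero] at hScoeff
    exact zero_ne_one hScoeff
  have hSdeg : S.totalDegree = 2 := isHomogeneous_sumSq.totalDegree hSne
  induction n with
  | zero =>
    refine ⟨by simp, ?_⟩
    simp
  | succ n ih =>
    obtain ⟨ihdeg, ihcoeff⟩ := ih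
    have hcoeff : MvPolynomial.coeff (Finsupp.single 0 (2 * (n + 1))) (S ^ (n + 1)) = 1 := by
      have h2 : 2 * (n + 1) = (S ^ n).totalDegree + S.totalDegree := by
        rw [ihdeg, hSdeg]
        ring
      rw [pow_succ, h2, coeff_single_zero_mul, ihdeg, hSdeg, ihcoeff, hScoeff, one_mul]
    refine ⟨le_antisymm ?_ ?_, hcoeff⟩
    · calc (S ^ (n + 1)).totalDegree ≤ (n + 1) * S.totalDegree := MvPolynomial.totalDegree_pow _ _
        _ = 2 * (n + 1) := by rw [hSdeg]; ring
    · have hmem : Finsupp.single (0 : Fin 4) (2 * (n + 1)) ∈ (S ^ (n + 1)).support := by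
        rw [MvPolynomial.mem_support_iff, hcoeff]
        exact one_ne_zero
      have h := MvPolynomial.le_totalDegree hmem
      have hsum : ((Finsupp.single (0 : Fin 4) (2 * (n + 1))).sum fun _ e => e) = 2 * (n + 1) :=
        Finsupp.sum_single_index rfl
      rwa [hsum] at h

/-- FULL DEGREE of `T(Σᵢ Xᵢ²)` for monic `T`: its total degree is `2·deg T` and the coefficient of `p₀^{2 deg T}` is `1`.
[folklore] -/
theorem fullDeg_aeval_sumSq (T : ℝ[X]) (hT : T.Monic) :
    (Polynomial.aeval (∑ j : Fin 4, (MvPolynomial.X j : MvPolynomial (Fin 4) ℝ) ^ 2) T).totalDegree = 2 * T.natDegree ∧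
    MvPolynomial.coeff (Finsupp.single 0
        (Polynomial.aeval (∑ j : Fin 4, (MvPolynomial.X j : MvPolynomial (Fin 4) ℝ) ^ 2) T).totalDegree)
      (Polynomial.aeval (∑ j : Fin 4, (MvPolynomial.X j : MvPolynomial (Fin 4) ℝ) ^ 2) T) ≠ 0 := by
  classical
  set S := ∑ j : Fin 4, (MvPolynomial.X j : MvPolynomial (Fin 4) ℝ) ^ 2 with hS
  set n := T.natDegree with hn
  set H := Polynomial.aeval S T with hH
  have hHsum : H = ∑ i ∈ Finset.range (n + 1), T.coeff i • S ^ i := by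
    rw [hH, Polynomial.aeval_eq_sum_range]
  -- upper bound on the total degree
  have hle : H.totalDegree ≤ 2 * n := by
    rw [hHsum]
    refine le_trans (MvPolynomial.totalDegree_finsetSum _ _) (Finset.sup_le fun i hi => ?_)
    refine le_trans (MvPolynomial.totalDegree_smul_le _ _) ?_
    rw [(sumSq_pow_top i).1]
    have := Finset.mem_range.1 hi
    omega
  -- the top coefficient
  have htop : MvPolynomial.coeff (Finsupp.single 0 (2 * n)) H = 1 := by
    rw [hHsum, MvPolynomial.coeff_sum, Finset.sum_eq_single n]
    · rw [MvPolynomial.coeff_smul, (sumSq_pow_top n).2, smul_eq_mul, mul_one]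
      exact hT.coeff_natDegree
    · intro i hi hin
      rw [MvPolynomial.coeff_smul]
      have hi' : i < n := lt_of_le_of_ne (by have := Finset.mem_range.1 hi; omega) hin
      have hhom : (S ^ i).IsHomogeneous (2 * i) := isHomogeneous_sumSq.pow i
      rw [hhom.coeff_eq_zero, smul_zero]
      rw [Finsupp.degree_single]
      omega
    · intro h
      exact absurd (Finset.self_mem_range_succ n) h
  have hge : 2 * n ≤ H.totalDegree := by
    have hmem : Finsupp.single (0 : Fin 4) (2 * n) ∈ H.support := by
      rw [MvPolynomial.mem_support_iff, htop]
      exact one_ne_zero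
    have h := MvPolynomial.le_totalDegree hmem
    have hsum : ((Finsupp.single (0 : Fin 4) (2 * n)).sum fun _ e => e) = 2 * n := Finsupp.sum_single_index rfl
    rwa [hsum] at h
  have hdeg : H.totalDegree = 2 * n := le_antisymm hle hge
  refine ⟨hdeg, ?_⟩
  rw [hdeg, htop]
  exact one_ne_zero

/-! ### 6. Invariance through a radial factor; derivative at a linear factor -/

/-- `T(Σᵢ Xᵢ²) ≠ 0` for `T ≠ 0`. [folklore] -/
theorem aeval_sumSq_ne_zero (T : ℝ[X]) (hT : T ≠ 0) :
    Polynomial.aeval (∑ j : Fin 4, (MvPolynomial.X j : MvPolynomial (Fin 4) ℝ) ^ 2) T ≠ 0 := by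
  intro h
  apply hT
  apply Polynomial.eq_zero_of_infinite_isRoot
  refine Set.Infinite.mono (s := Set.Ici (0 : ℝ)) ?_ (Set.Ici_infinite _)
  intro x hx
  rw [Set.mem_Ici] at hx
  rw [Set.mem_setOf_eq, Polynomial.IsRoot.def]
  have hp := congrArg (MvPolynomial.eval (Fin.cons (Real.sqrt x) (fun _ : Fin 3 => (0 : ℝ)) : Fin 4 → ℝ)) h
  rw [eval_aeval_sumSq, map_zero, sumSq_cons] at hp
  simpa [Real.sq_sqrt hx] using hp

/-- An invariance of `T(Σᵢ Xᵢ²)·N₁` under a continuous map preserving `Σᵢ pᵢ²` passes to `N₁` (`T ≠ 0`). [folklore] -/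
theorem invariant_of_mul_radial (T : ℝ[X]) (hT : T ≠ 0) (N₁ : MvPolynomial (Fin 4) ℝ)
    (g : (Fin 4 → ℝ) → (Fin 4 → ℝ)) (hg : Continuous g) (hgsq : ∀ p, ∑ i, (g p) i ^ 2 = ∑ i, p i ^ 2)
    (hinv : ∀ p : Fin 4 → ℝ,
      MvPolynomial.eval (g p) (Polynomial.aeval (∑ j : Fin 4, (MvPolynomial.X j : MvPolynomial (Fin 4) ℝ) ^ 2) T * N₁) =
      MvPolynomial.eval p (Polynomial.aeval (∑ j : Fin 4, (MvPolynomial.X j : MvPolynomial (Fin 4) ℝ) ^ 2) T * N₁)) :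
    ∀ p : Fin 4 → ℝ, MvPolynomial.eval (g p) N₁ = MvPolynomial.eval p N₁ := by
  set H := Polynomial.aeval (∑ j : Fin 4, (MvPolynomial.X j : MvPolynomial (Fin 4) ℝ) ^ 2) T with hH
  have hHne : H ≠ 0 := aeval_sumSq_ne_zero T hT
  have hdense := dense_setOf_eval_ne_zero H hHne
  have hcont1 : Continuous fun p : Fin 4 → ℝ => MvPolynomial.eval (g p) N₁ :=
    (MvPolynomial.continuous_eval (p := N₁)).comp hg
  have hcont2 : Continuous fun p : Fin 4 → ℝ => MvPolynomial.eval p N₁ := MvPolynomial.continuous_eval (p := N₁)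
  have heq := Continuous.ext_on hdense hcont1 hcont2 fun p hp => by
    rw [Set.mem_setOf_eq, hH, eval_aeval_sumSq] at hp
    have h := hinv p
    rw [map_mul, map_mul, hH, eval_aeval_sumSq, eval_aeval_sumSq, hgsq] at h
    exact mul_left_cancel₀ hp h
  intro p
  exact congrFun heq p

/-- `((X − ρ)·Q)′(ρ) = Q(ρ)`. [folklore] -/
theorem derivative_eval_root_of_mul (ρ : ℝ) (Q R : ℝ[X]) (h : R = (Polynomial.X - Polynomial.C ρ) * Q) :
    R.derivative.eval ρ = Q.eval ρ := by
  rw [h, Polynomial.derivative_mul, Polynomial.derivative_X_sub_C]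
  simp

end Summit.QuantumFields.YangMills.Theorems.RationalShortRootRigidity.Alternation
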